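import Summits.ValiantsHypothesis.ValiantsHypothesis.Theorems.LacunarySymmetroidMatrixDescartesDoorA26WallBubblingWeylGenericSingleCluster
import Summits.ValiantsHypothesis.ValiantsHypothesis.Theorems.LacunarySymmetroidMatrixDescartesDoorA26WallBubblingWeylTripleLimit

/-!
# Wall bubbling for `DoorA26` — WEYL TRIPLES: no bounded-ratio twenties near a value-generic triple (`x`-currency corollary)

HONEST FRAMING.  Obligation (W) `Stmt.stub_weylFaces` of `Cruxes/DoorA26/Lines/wall_bubbling.lean` (crux `DoorA26`, stmt-ValiantsHypothesis-19979;
OPEN, typed, never asserted); statement file `Cruxes/DoorA26/Lines/wall_bubbling_ConfluentDoor.lean` rev 13, hypothesis `TripleStratum26` of the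
(W) ledger «(W) ⟸ ConfluentDoor26 ∧ NoTightChain26NC ∧ (M) ∧ TripleStratum26» — its GENERIC stratum: a triple `δ₃ = δ₄ = δ₅` and three simple values,
the four values value-generic (2-Sidon).  W1 seat val-sym-door-p2 g15 (#90); `x`-currency companion of #89, as W1 #33's `no_boundedRatio_twenties_threeWeylPairs`.  Def-free:

* `no_boundedRatio_twenties_weylTriple` — the `x`-currency corollary of #89 `no_twenty_window_weylTriple` (door-free single-cluster theorem at the
  generic Weyl-triple stratum): no bounded-ratio twenties (`x_k ≤ R·x_0` at every stage) near a value-generic point with a triple.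

The multi-cluster case (rungs in slot currency; what a «sixth-slot cluster» costs elsewhere) and the deeper patterns [3,2,1]/[3,3]/[4,1,1]/[4,2]/[5,1]
of `TripleStratum26` are NOT treated here.  Registers unchanged; `TripleStratum26`, (W), (M), `ConfluentDoor26`, `NoTightChain26NC`, `DoorA26`,
`MatrixDescartes` (stmt-ValiantsHypothesis-18050) OPEN; nothing on VP ≠ VNP.  `--supports stmt-ValiantsHypothesis-19979 --as helper`.  [this work].
-/

-- `Summit.ValiantsHypothesis.ValiantsHypothesis.…` repeats a component by the D-0017 layout
-- (single-conjunct summit), which the `dupNamespace` linter flags; the name is mandated.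
set_option linter.dupNamespace false

namespace Summit.ValiantsHypothesis.ValiantsHypothesis.Theorems.LacunarySymmetroidMatrixDescartes.WallBubbling

open Finset Filter Topology
open scoped BigOperators

/-- **NO BOUNDED-RATIO TWENTIES NEAR A VALUE-GENERIC WEYL TRIPLE — NO DOOR** (`x`-currency: twenty positive roots `x_k` of
`det Σ_l x^{δ_l} S_l` with `x_k ≤ R·x_0` at every stage). [this work] -/
theorem no_boundedRatio_twenties_weylTriple
    (δ0 : Fin 6 → ℝ) (h43 : δ0 4 = δ0 3) (h53 : δ0 5 = δ0 3)
    (hvg : ∀ a b c d : Fin 4, δ0 a.castSucc.castSucc + δ0 b.castSucc.castSucc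
        = δ0 c.castSucc.castSucc + δ0 d.castSucc.castSucc → (a = c ∧ b = d) ∨ (a = d ∧ b = c))
    (δs : ℕ → Fin 6 → ℝ) (hδ : ∀ l, Tendsto (fun ν => δs ν l) atTop (𝓝 (δ0 l)))
    (S : ℕ → Fin 6 → Matrix (Fin 2) (Fin 2) ℝ) (hS : ∀ ν l, (S ν l).IsSymm)
    (hne : ∀ ν, ∃ y : ℝ, 0 < y ∧ (∑ l, (y ^ (δs ν l)) • S ν l).det ≠ 0)
    (R : ℝ) (x : ℕ → Fin 20 → ℝ) (hx : ∀ ν, StrictMono (x ν)) (hxpos : ∀ ν k, 0 < x ν k)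
    (hxR : ∀ ν k, x ν k ≤ R * x ν 0) (hroot : ∀ ν k, (∑ l, (x ν k ^ (δs ν l)) • S ν l).det = 0) : False := by
  have hR : 0 < R := by
    have h1 := hxR 0 0
    have h2 := hxpos 0 0
    nlinarith
  refine no_twenty_window_weylTriple δs δ0 hδ h43 h53 hvg
    (fun ν l => (x ν 0 ^ (δs ν l)) • S ν l) (fun ν l => (hS ν l).smul _) ?_ 0 (Real.log R) ?_
  · intro ν
    obtain ⟨y, hy, hdet⟩ := hne ν
    refine ⟨Real.log y - Real.log (x ν 0), ?_⟩
    rw [← pencil_log_recenter (δs ν) (S ν) (hxpos ν 0) hy]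
    exact hdet
  · intro ν
    refine ⟨fun k => Real.log (x ν k) - Real.log (x ν 0), fun k k' hkk' => ?_, fun k => ⟨⟨?_, ?_⟩, ?_⟩⟩
    · exact sub_lt_sub_right (Real.log_lt_log (hxpos ν k) (hx ν hkk')) _
    · exact sub_nonneg.mpr (Real.log_le_log (hxpos ν 0) ((hx ν).monotone (Fin.zero_le k)))
    · rw [sub_le_iff_le_add, ← Real.log_mul hR.ne' (hxpos ν 0).ne']
      exact Real.log_le_log (hxpos ν k) (hxR ν k)
    · rw [← pencil_log_recenter (δs ν) (S ν) (hxpos ν 0) (hxpos ν k)]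
      exact hroot ν k

end Summit.ValiantsHypothesis.ValiantsHypothesis.Theorems.LacunarySymmetroidMatrixDescartes.WallBubbling
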